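import Summits.QuantumFields.YangMills.Theses.DualityDefect
import Summits.QuantumFields.YangMills.Theorems.DualityDefectCloverParityRPClover
import Summits.QuantumFields.GaugeBoot.ClassBLimitSiteRP
import Summits.QuantumFields.GaugeBoot.ClassBLimitLinkRP
import Literature.MathematicalPhysics.QuantumLattice.CloverObservables
import HarnessLib

/-!
# Route `DualityDefect`: the support item `CloverParityRP` (stmt-QuantumFields-11698)

RP SIGN RULES for the clover channels: for every compact simple `G`, every lattice representation
`r`, every `β ≥ 0`, every infinite-volume limit point `μ` of the torus Wilson states and every
`n ≥ 2`, the axis covariances of the bare clover densities satisfy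
`A(n) = Cov_μ(S₀, S_{n e₀}) ≥ 0` and `B(n) = −Cov_μ(P₀, P_{n e₀}) ≥ 0`.

Proof (Osterwalder–Seiler): `S` is even and `P` odd under time reflections (tree
`flowedCloverEnergy_zero_reflect`, `cloverPseudoscalar_reflect`, instantiated for the `ℤ⁴` mirrors in
`DualityDefectCloverParityRPClover`); limit points are translation invariant
(`isZdTranslationInvariant_of_mem_infiniteVolumeLimitPoints`) and reflection positive for the site
mirror `x₀ = 0` and the link mirror `x₀ = ½` (`GaugeBoot.siteRP_zero_of_mem_infiniteVolumeLimitPoints`,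
`GaugeBoot.linkRP_zero_of_mem_infiniteVolumeLimitPoints`). For `n = 2m` translate by `−m e₀` and use
the site mirror (`S_{m e₀}` lives in `{x₀ ≥ 0}` as soon as `m ≥ 1`); for `n = 2m + 1` use the link
mirror (`S_{(m+1)e₀}` lives in `{x₀ ≥ 1}`). Reflection positivity applied to `F − ⟨F⟩` is the
covariance inequality `ε · Cov(F ∘ Θ / ε, F) ≥ 0`. Nothing here bears on the Yang–Mills mass gap; no
summit, leg or crux statement is proved (seat ym-line-fcl-p3 g19, free hands).
-/

noncomputable section

open MeasureTheory
open scoped ComplexOrder ComplexConjugate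
open Literature.MathematicalPhysics.QuantumLattice
open Literature.MathematicalPhysics.QuantumFieldTheory (LatticeRep)
open Literature.Probability.LatticeModels (Site)
open Summit.QuantumFields.GaugeBoot

namespace Summit.QuantumFields.YangMills.Theorems

namespace CloverParityRP

/-! ### Reflection positivity as a covariance inequality -/

section RP

variable {d : ℕ} {G : Type*} [Group G] [MeasurableSpace G]

omit [Group G] in
/-- A bounded measurable real function is integrable for a finite measure. -/
theorem integrable_of_abs_le {μ : Measure (LGConfig d G)} [IsFiniteMeasure μ]
    {F : LGConfig d G → ℝ} (hFm : Measurable F) {C : ℝ} (hC : ∀ U, |F U| ≤ C) : Integrable F μ :=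
  (integrable_const C).mono' hFm.aestronglyMeasurable
    (ae_of_all _ fun U => by rw [Real.norm_eq_abs]; exact hC U)

omit [Group G] in
/-- **Reflection positivity on a real observable shifted by a constant**:
`0 ≤ ∫ (F(ΘU) − c)(F(U) − c) dμ`. -/
theorem rp_sub_const_nonneg {Θ : LGConfig d G → LGConfig d G} {S : Set (ZdEdge d)}
    {μ : Measure (LGConfig d G)} (hRP : IsReflectionPositiveFor Θ S μ) {F : LGConfig d G → ℝ}
    (hFm : Measurable F) (hFb : ∃ C, ∀ U, |F U| ≤ C) (hFS : DependsOn F S) (c : ℝ) :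
    0 ≤ ∫ U, (F (Θ U) - c) * (F U - c) ∂μ := by
  obtain ⟨C, hC⟩ := hFb
  have h := hRP (fun U => ((F U - c : ℝ) : ℂ)) (Complex.measurable_ofReal.comp (hFm.sub_const c))
    ⟨C + |c|, fun U => by
      rw [Complex.norm_real, Real.norm_eq_abs]
      exact (abs_sub (F U) c).trans (by linarith [hC U])⟩
    (fun U V hUV => by simp only [hFS hUV])
  have hre : ∫ U, (starRingEnd ℂ) (((F (Θ U) - c : ℝ) : ℂ)) * ((F U - c : ℝ) : ℂ) ∂μ =
      ((∫ U, (F (Θ U) - c) * (F U - c) ∂μ : ℝ) : ℂ) := by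
    simp_rw [Complex.conj_ofReal, ← Complex.ofReal_mul]
    exact integral_ofReal
  rw [hre] at h
  exact Complex.zero_le_real.1 h

omit [Group G] in
/-- **Reflection positivity is a covariance inequality.** If `F` lives on the closed half of the
mirror and `F ∘ Θ = ε · Fᵣ`, then `ε · Cov_μ(Fᵣ, F) ≥ 0` (apply RP to `F − ⟨F⟩`). -/
theorem cov_mul_nonneg_of_rp {Θ : LGConfig d G → LGConfig d G} {S : Set (ZdEdge d)}
    {μ : Measure (LGConfig d G)} [IsProbabilityMeasure μ] (hRP : IsReflectionPositiveFor Θ S μ)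
    {F Fr : LGConfig d G → ℝ} (hFm : Measurable F) (hFb : ∃ C, ∀ U, |F U| ≤ C)
    (hFS : DependsOn F S) (hFrm : Measurable Fr) (hFrb : ∃ C, ∀ U, |Fr U| ≤ C) (ε : ℝ)
    (hrefl : ∀ U, F (Θ U) = ε * Fr U) :
    0 ≤ ε * (∫ U, Fr U * F U ∂μ - (∫ U, Fr U ∂μ) * ∫ U, F U ∂μ) := by
  set c := ∫ U, F U ∂μ with hc
  have h := rp_sub_const_nonneg hRP hFm hFb hFS c
  obtain ⟨C, hC⟩ := hFb
  obtain ⟨C', hC'⟩ := hFrb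
  have hFi : Integrable F μ := integrable_of_abs_le hFm hC
  have hFri : Integrable Fr μ := integrable_of_abs_le hFrm hC'
  have hprod : Integrable (fun U => Fr U * F U) μ :=
    integrable_of_abs_le (hFrm.mul hFm) (C := C' * C) fun U => by
      rw [abs_mul]
      exact mul_le_mul (hC' U) (hC U) (abs_nonneg _) ((abs_nonneg _).trans (hC' U))
  have e1 : (fun U => (F (Θ U) - c) * (F U - c)) =
      fun U => ε * (Fr U * F U) - c * ε * Fr U - c * F U + c * c := by
    funext U; rw [hrefl U]; ring
  have i1 : Integrable (fun U => ε * (Fr U * F U)) μ := hprod.const_mul ε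
  have i2 : Integrable (fun U => c * ε * Fr U) μ := hFri.const_mul _
  have i3 : Integrable (fun U => c * F U) μ := hFi.const_mul _
  have hexp : ∫ U, ε * (Fr U * F U) - c * ε * Fr U - c * F U + c * c ∂μ =
      ε * ∫ U, Fr U * F U ∂μ - c * ε * ∫ U, Fr U ∂μ - c * ∫ U, F U ∂μ + c * c := by
    rw [integral_add ((i1.sub' i2).sub' i3) (integrable_const _), integral_sub (i1.sub' i2) i3,
      integral_sub i1 i2, integral_const_mul, integral_const_mul, integral_const_mul, integral_const,
      smul_eq_mul, probReal_univ, one_mul]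
  rw [e1, hexp, ← hc] at h
  nlinarith [h]

end RP

/-! ### Mirrors applied to the time axis -/

section Axis

variable {d : ℕ} [NeZero d]

/-- The site mirror on the time axis: `θ(z e₀) = −z e₀`. -/
theorem zdSiteReflect_zsmul_single (z : ℤ) :
    zdSiteReflect (0 : Fin d) (z • Pi.single 0 1) = (-z) • Pi.single 0 1 := by
  ext k
  by_cases hk : k = 0
  · subst hk; simp [zdSiteReflect]
  · simp [zdSiteReflect, hk]

/-- The link mirror on the time axis: `θ(z e₀) = (1 − z) e₀`. -/
theorem zdLinkReflect_zsmul_single (z : ℤ) :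
    zdLinkReflect (0 : Fin d) (z • Pi.single 0 1) = (1 - z) • Pi.single 0 1 := by
  ext k
  by_cases hk : k = 0
  · subst hk; simp [zdLinkReflect]
  · simp [zdLinkReflect, hk]

end Axis

/-! ### The axis covariance of an even/odd local density -/

section Main

variable {G : Type*} [Group G] [TopologicalSpace G] [IsTopologicalGroup G] [CompactSpace G]
  [MeasurableSpace G] [BorelSpace G]

/-- **`ε · Cov_μ(D₀, D_{n e₀}) ≥ 0` for a limit point `μ`**, for any family of bounded measurable
densities `D_x` which is translation covariant, lives on `{t ≥ x₀ − 1}` and satisfies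
`D_x ∘ Θ = ε D_{θx}` for the two time mirrors: `n = 2m` by the site mirror after translating by
`−m e₀`, `n = 2m + 1` by the link mirror. -/
theorem axisCov_mul_nonneg (r : LatticeRep G) {β : ℝ} (hβ : 0 ≤ β) {μ : Measure (LGConfig 4 G)}
    (hμ : μ ∈ infiniteVolumeLimitPoints (d := 4) r.ρ β) (D : Site 4 → LGConfig 4 G → ℝ)
    (hDm : ∀ x, Measurable (D x)) (hDb : ∀ x, ∃ C, ∀ U, |D x U| ≤ C)
    (hDshift : ∀ v x U, D x (configShift v U) = D (x - v) U)
    (hDsite : ∀ x, 1 ≤ x 0 → DependsOn (D x) (siteHalfEdges 0))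
    (hDlink : ∀ x, 2 ≤ x 0 → DependsOn (D x) (linkHalfEdges 0)) (ε : ℝ)
    (hDs : ∀ x U, D x (configSiteReflect 0 U) = ε * D (zdSiteReflect 0 x) U)
    (hDl : ∀ x U, D x (configLinkReflect 0 U) = ε * D (zdLinkReflect 0 x) U) {n : ℕ} (hn : 2 ≤ n) :
    0 ≤ ε * (∫ U, D 0 U * D ((n : ℤ) • Pi.single 0 1) U ∂μ -
      (∫ U, D 0 U ∂μ) * ∫ U, D ((n : ℤ) • Pi.single 0 1) U ∂μ) := by
  haveI : T2Space G := (r.continuous.isClosedEmbedding r.injective).isEmbedding.t2Space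
  haveI : SecondCountableTopology G :=
    (r.continuous.isClosedEmbedding r.injective).isEmbedding.secondCountableTopology
  obtain ⟨_, _, hprob, _⟩ := id hμ
  have hTI := isZdTranslationInvariant_of_mem_infiniteVolumeLimitPoints r.ρ hμ
  obtain ⟨m, hm⟩ := Nat.even_or_odd' n
  have hshift : ∀ F : LGConfig 4 G → ℝ,
      ∫ U, F (configShift ((m : ℤ) • Pi.single 0 1) U) ∂μ = ∫ U, F U ∂μ := fun F => by
    rw [← integral_map_equiv, hTI]
  have h0 : (0 : Site 4) - (m : ℤ) • Pi.single 0 1 = (-(m : ℤ)) • Pi.single 0 1 := by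
    rw [zero_sub, neg_smul]
  have hn' : ((n : ℤ) • Pi.single 0 1 : Site 4) - (m : ℤ) • Pi.single 0 1 =
      ((n : ℤ) - m) • Pi.single 0 1 := by rw [sub_smul]
  have I1 : ∫ U, D 0 U * D ((n : ℤ) • Pi.single 0 1) U ∂μ =
      ∫ U, D ((-(m : ℤ)) • Pi.single 0 1) U * D (((n : ℤ) - m) • Pi.single 0 1) U ∂μ := by
    refine (hshift (fun U => D 0 U * D ((n : ℤ) • Pi.single 0 1) U)).symm.trans ?_
    simp only [hDshift, h0, hn']
  have I2 : ∫ U, D 0 U ∂μ = ∫ U, D ((-(m : ℤ)) • Pi.single 0 1) U ∂μ := by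
    refine (hshift (D 0)).symm.trans ?_
    simp only [hDshift, h0]
  have I3 : ∫ U, D ((n : ℤ) • Pi.single 0 1) U ∂μ = ∫ U, D (((n : ℤ) - m) • Pi.single 0 1) U ∂μ := by
    refine (hshift (D _)).symm.trans ?_
    simp only [hDshift, hn']
  rw [I1, I2, I3]
  rcases hm with rfl | rfl
  · have hm1 : 1 ≤ m := by omega
    have ha : (((2 * m : ℕ) : ℤ) - m) = m := by push_cast; ring
    rw [ha]
    refine cov_mul_nonneg_of_rp (siteRP_zero_of_mem_infiniteVolumeLimitPoints r.ρ r.continuous hβ hμ)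
      (hDm _) (hDb _) (hDsite _ ?_) (hDm _) (hDb _) ε fun U => ?_
    · simpa using (show (1 : ℤ) ≤ m by exact_mod_cast hm1)
    · rw [hDs, zdSiteReflect_zsmul_single]
  · have hm1 : 1 ≤ m := by omega
    have ha : (((2 * m + 1 : ℕ) : ℤ) - m) = m + 1 := by push_cast; ring
    rw [ha]
    refine cov_mul_nonneg_of_rp (linkRP_zero_of_mem_infiniteVolumeLimitPoints r.ρ r.continuous hβ hμ)
      (hDm _) (hDb _) (hDlink _ ?_) (hDm _) (hDb _) ε fun U => ?_
    · simpa using (show (2 : ℤ) ≤ m + 1 by omega)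
    · rw [hDl, zdLinkReflect_zsmul_single]
      congr 3
      ring

end Main

end CloverParityRP

/-! ### The item -/

open CloverParityRP in
/-- **Route `DualityDefect`, support item `CloverParityRP` (stmt-QuantumFields-11698): the RP sign
rules `A(n) = Cov(S₀, S_{ne₀}) ≥ 0`, `B(n) = −Cov(P₀, P_{ne₀}) ≥ 0` (`n ≥ 2`) for the bare clover
densities in every infinite-volume limit point of the torus Wilson states, `β ≥ 0`.** -/
theorem dualityDefect_cloverParityRP_proof : Theses.DualityDefect.CloverParityRP := by
  intro G _ _ _ _ _ _ hG r S P e A B β hβ μ hμ n hn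
  haveI : SecondCountableTopology G :=
    (r.continuous.isClosedEmbedding r.injective).isEmbedding.secondCountableTopology
  have hA : 0 ≤ 1 * (∫ U, flowedCloverEnergy r.ρ 0 0 U *
      flowedCloverEnergy r.ρ 0 ((n : ℤ) • Pi.single 0 1) U ∂μ -
      (∫ U, flowedCloverEnergy r.ρ 0 0 U ∂μ) *
        ∫ U, flowedCloverEnergy r.ρ 0 ((n : ℤ) • Pi.single 0 1) U ∂μ) :=
    axisCov_mul_nonneg r hβ hμ (fun x U => flowedCloverEnergy r.ρ 0 x U)
      (fun x => measurable_flowedCloverEnergy_zero r.ρ r.continuous x)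
      (fun x => exists_abs_flowedCloverEnergy_zero_le r.ρ r.continuous x)
      (fun v x U => flowedCloverEnergy_zero_configShift r.ρ v x U)
      (fun x hx => dependsOn_flowedCloverEnergy_siteHalf r.ρ hx)
      (fun x hx => dependsOn_flowedCloverEnergy_linkHalf r.ρ hx) 1
      (fun x U => by rw [one_mul]; exact flowedCloverEnergy_zero_configSiteReflect r.ρ r.mem_unitary x U)
      (fun x U => by rw [one_mul]; exact flowedCloverEnergy_zero_configLinkReflect r.ρ r.mem_unitary x U)
      hn
  have hB : 0 ≤ (-1) * (∫ U, cloverPseudoscalar r.ρ 0 U *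
      cloverPseudoscalar r.ρ ((n : ℤ) • Pi.single 0 1) U ∂μ -
      (∫ U, cloverPseudoscalar r.ρ 0 U ∂μ) *
        ∫ U, cloverPseudoscalar r.ρ ((n : ℤ) • Pi.single 0 1) U ∂μ) :=
    axisCov_mul_nonneg r hβ hμ (fun x U => cloverPseudoscalar r.ρ x U)
      (fun x => measurable_cloverPseudoscalar r.ρ r.continuous x)
      (fun x => exists_abs_cloverPseudoscalar_le r.ρ r.continuous x)
      (fun v x U => cloverPseudoscalar_configShift r.ρ v x U)
      (fun x hx => dependsOn_cloverPseudoscalar_siteHalf r.ρ hx)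
      (fun x hx => dependsOn_cloverPseudoscalar_linkHalf r.ρ hx) (-1)
      (fun x U => by rw [neg_one_mul]; exact cloverPseudoscalar_configSiteReflect r.ρ r.mem_unitary x U)
      (fun x U => by rw [neg_one_mul]; exact cloverPseudoscalar_configLinkReflect r.ρ r.mem_unitary x U)
      hn
  have hB' : 0 ≤ (∫ U, cloverPseudoscalar r.ρ 0 U ∂μ) *
      (∫ U, cloverPseudoscalar r.ρ ((n : ℤ) • Pi.single 0 1) U ∂μ) -
      ∫ U, cloverPseudoscalar r.ρ 0 U * cloverPseudoscalar r.ρ ((n : ℤ) • Pi.single 0 1) U ∂μ := by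
    linarith
  rw [one_mul] at hA
  exact ⟨hA, hB'⟩

end Summit.QuantumFields.YangMills.Theorems

end
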